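import Summits.CriticalPhenomena.CardyFormulaZ2.Theorems.CardyBoundaryCoulombGasStripClusterRatesConfinedGlueTransfer
import Summits.CriticalPhenomena.CardyFormulaZ2.Theorems.CardyBoundaryCoulombGasStripClusterRatesDockingSeparator
import HarnessLib

/-!
# Crux `StripClusterRates` (stmt-CriticalPhenomena-13878), line two-cluster-rate-is-stationary-gap (lead c8):
path-building helpers for the registered stub `c8_confinedOfDocked` (deterministic end surgery)

Support file (`--supports stmt-CriticalPhenomena-13878`), first half of the stub `c8_confinedOfDocked`
(landed in `…ConfinedOfDocked.lean`, which imports this file).  Width `n = 3b+2`, long block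
`R' = [0, M'] × [0, n]` with `M' = M + 2(b+3)`, plain block `B = [b+3, b+3+M] × [0, n]`.  Contents:

* coordinates of lattice points `pt i j`, lattice edges in coordinates, straight horizontal / vertical
  open runs (`cod_hrun`, `cod_vrun`), a dual step across a closed primal edge is dual-open
  (`cod_dual_hstep`, `cod_dual_vstep`, through `dks_mem_dualConfig` of `…DockingSeparator`),
  and the translated top-bottom fence event from an explicit open column (`cod_mem_preimage_relabel_tbCrossing`);
* four of the five pieces of the end-confined event `F(M', b)` of `…ConfinedGlueTransfer` built from the
  docked data of `B` and the OPEN edges of the two end patterns, given in coordinates: the two left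
  fences (column `0`, `cod_fenceBottom`, `cod_fenceTop`), the confined bottom crossing "row `0` + column
  `b+2` + LOW path + column `M+b+4` + row `0`" (`cod_confinedBottom`, the one registered sub-goal of this file) and the confined top crossing (`cod_confinedTop`).

Elementary lattice bookkeeping (Bollobás–Riordan 2006, Ch. 3; Grimmett 1999, §11.2). [folklore]
-/

noncomputable section

open MeasureTheory Filter Topology Set
open Literature.Probability.LatticeModels Literature.Probability.Percolation

namespace Summit.CriticalPhenomena.CardyFormulaZ2.Cruxes.StripClusterRates.TwoClusterRateIsStationaryGap

/-! ## Coordinates, lattice edges, straight open runs -/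

/-- Equality of two pairs of lattice points, in coordinates. [folklore] -/
theorem cod_mk_eq_iff {x j y k x' j' y' k' : ℤ} :
    s(pt x j, pt y k) = s(pt x' j', pt y' k') ↔
      (x = x' ∧ j = j' ∧ y = y' ∧ k = k') ∨ (x = y' ∧ j = k' ∧ y = x' ∧ k = j') := by
  rw [Sym2.eq_iff]
  simp only [Site.eq_iff_two, pt, Matrix.cons_val_zero, Matrix.cons_val_one, Matrix.cons_val_fin_one,
    and_assoc]

/-- Horizontal unit segments are lattice edges. [folklore] -/
theorem cod_hedge_mem {x x' j : ℤ} (hx : x' = x + 1) : s(pt x j, pt x' j) ∈ (zdGraph 2).edgeSet := by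
  subst hx; rw [pt_succ_eq]; exact single_edge_mem _ 0

/-- Vertical unit segments are lattice edges. [folklore] -/
theorem cod_vedge_mem {x j j' : ℤ} (hj : j' = j + 1) : s(pt x j, pt x j') ∈ (zdGraph 2).edgeSet := by
  subst hj; rw [pt_succ_eq']; exact single_edge_mem _ 1

/-- Both endpoints of a pair of rectangle points lie in the rectangle. [folklore] -/
theorem cod_edge_rect {m n : ℕ} {x j y k : ℤ} (h : 0 ≤ x ∧ x ≤ m ∧ 0 ≤ j ∧ j ≤ n)
    (h' : 0 ≤ y ∧ y ≤ m ∧ 0 ≤ k ∧ k ≤ n) :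
    ∀ z ∈ s(pt x j, pt y k), z ∈ (rectangle m n : Set (Site 2)) := by
  intro z hz
  rcases Sym2.mem_iff.1 hz with rfl | rfl <;>
    simpa [mem_rectangle_iff, pt] using ‹_ ∧ _›

/-- A pair whose first point has abscissa `≤ c` meets the columns `≤ c`. [folklore] -/
theorem cod_exists_mem_le {x j y k c : ℤ} (h : x ≤ c) : ∃ z ∈ s(pt x j, pt y k), z 0 ≤ c :=
  ⟨pt x j, Sym2.mem_mk_left _ _, h⟩

/-- A pair whose second point has abscissa `≥ c` meets the columns `≥ c`. [folklore] -/
theorem cod_exists_mem_ge {x j y k c : ℤ} (h : c ≤ y) : ∃ z ∈ s(pt x j, pt y k), c ≤ z 0 :=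
  ⟨pt y k, Sym2.mem_mk_right _ _, h⟩

/-- Left-side points in coordinates. [folklore] -/
theorem cod_mem_leftSide {m n : ℕ} {x j : ℤ} (h : x = 0 ∧ 0 ≤ j ∧ j ≤ n) :
    pt x j ∈ (leftSide m n : Set (Site 2)) := by
  simp only [Finset.mem_coe, leftSide, Finset.mem_filter, mem_rectangle_iff, pt, Matrix.cons_val_zero,
    Matrix.cons_val_one, Matrix.cons_val_fin_one]
  omega

/-- Right-side points in coordinates. [folklore] -/
theorem cod_mem_rightSide {m n : ℕ} {x j : ℤ} (h : x = m ∧ 0 ≤ j ∧ j ≤ n) :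
    pt x j ∈ (rightSide m n : Set (Site 2)) := by
  simp only [Finset.mem_coe, rightSide, Finset.mem_filter, mem_rectangle_iff, pt, Matrix.cons_val_zero,
    Matrix.cons_val_one, Matrix.cons_val_fin_one]
  omega

/-- Points of the left dual side (faces of abscissa `-1`) in coordinates. [folklore] -/
theorem cod_mem_image_leftSide {m n : ℕ} {x j : ℤ} (h : x = -1 ∧ 0 ≤ j ∧ j ≤ n) :
    pt x j ∈ (· + pt (-1) 0) '' (leftSide m n : Set (Site 2)) := by
  rw [mem_image_add_leftSide]
  simp only [pt, Matrix.cons_val_zero, Matrix.cons_val_one, Matrix.cons_val_fin_one]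
  omega

/-- Points of the right dual side (faces of abscissa `m - 1`) in coordinates. [folklore] -/
theorem cod_mem_image_rightSide {m n : ℕ} {x j : ℤ} (h : x + 1 = m ∧ 0 ≤ j ∧ j ≤ n) :
    pt x j ∈ (· + pt (-1) 0) '' (rightSide m n : Set (Site 2)) := by
  rw [mem_image_add_rightSide]
  simp only [pt, Matrix.cons_val_zero, Matrix.cons_val_one, Matrix.cons_val_fin_one]
  omega

/-- **A straight horizontal open run**: if the points `(x, j)`, `a ≤ x ≤ a'`, lie in `S` and the edges
between consecutive ones are open, then `(a, j) ↔ (a', j)` in `S`. [folklore] -/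
theorem cod_hrun {S : Set (Site 2)} {ω : BondConfig (Site 2)} {a a' j : ℤ} (haa' : a ≤ a')
    (hS : ∀ x : ℤ, a ≤ x → x ≤ a' → pt x j ∈ S)
    (hE : ∀ x : ℤ, a ≤ x → x < a' → s(pt x j, pt (x + 1) j) ∈ ω) :
    ω ∈ openConnIn S (pt a j) (pt a' j) := by
  obtain ⟨k, rfl⟩ : ∃ k : ℕ, a' = a + k := ⟨(a' - a).toNat, by omega⟩
  clear haa'
  induction k with
  | zero => simpa using openConnIn_refl (hS a le_rfl (by omega))
  | succ k ih =>
    have h1 := ih (fun x hx hx' => hS x hx (by push_cast; omega))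
      (fun x hx hx' => hE x hx (by push_cast; omega))
    have h2 : ω ∈ openConnIn S (pt (a + k) j) (pt (a + k + 1) j) :=
      openConnIn_of_adj (hS _ (by omega) (by push_cast; omega)) (hS _ (by omega) (by push_cast; omega))
        (hE _ (by omega) (by push_cast; omega)) (fun h => by have := congr_fun h 0; simp [pt] at this)
    rw [Nat.cast_succ, ← add_assoc]
    exact PlanarDuality.openConnIn_trans h1 h2

/-- **A straight vertical open run**: if the points `(x, j)`, `a ≤ j ≤ a'`, lie in `S` and the edges
between consecutive ones are open, then `(x, a) ↔ (x, a')` in `S`. [folklore] -/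
theorem cod_vrun {S : Set (Site 2)} {ω : BondConfig (Site 2)} {x a a' : ℤ} (haa' : a ≤ a')
    (hS : ∀ j : ℤ, a ≤ j → j ≤ a' → pt x j ∈ S)
    (hE : ∀ j : ℤ, a ≤ j → j < a' → s(pt x j, pt x (j + 1)) ∈ ω) :
    ω ∈ openConnIn S (pt x a) (pt x a') := by
  obtain ⟨k, rfl⟩ : ∃ k : ℕ, a' = a + k := ⟨(a' - a).toNat, by omega⟩
  clear haa'
  induction k with
  | zero => simpa using openConnIn_refl (hS a le_rfl (by omega))
  | succ k ih =>
    have h1 := ih (fun y hy hy' => hS y hy (by push_cast; omega))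
      (fun y hy hy' => hE y hy (by push_cast; omega))
    have h2 : ω ∈ openConnIn S (pt x (a + k)) (pt x (a + k + 1)) :=
      openConnIn_of_adj (hS _ (by omega) (by push_cast; omega)) (hS _ (by omega) (by push_cast; omega))
        (hE _ (by omega) (by push_cast; omega)) (fun h => by have := congr_fun h 1; simp [pt] at this)
    rw [Nat.cast_succ, ← add_assoc]
    exact PlanarDuality.openConnIn_trans h1 h2

/-- An open horizontal edge inside `S` joins its endpoints in `S`. [folklore] -/
theorem cod_adj_h {S : Set (Site 2)} {ω : BondConfig (Site 2)} {x x' j : ℤ} (hx : x' = x + 1)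
    (h1 : pt x j ∈ S) (h2 : pt x' j ∈ S) (he : s(pt x j, pt x' j) ∈ ω) :
    ω ∈ openConnIn S (pt x j) (pt x' j) :=
  openConnIn_of_adj h1 h2 he (fun h => by have := congr_fun h 0; simp [pt] at this; omega)

/-! ## Dual steps across closed edges; the translated fence event -/

/-- A horizontal dual step `(x, j) → (x+1, j)` of faces is dual-open if the vertical primal edge
`{(x+1, j), (x+1, j+1)}` it crosses is closed. [folklore] -/
theorem cod_dual_hstep {ω : BondConfig (Site 2)} (hω : ω ⊆ (zdGraph 2).edgeSet) {x x' j j' : ℤ}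
    (hx : x' = x + 1) (hj : j' = j + 1) (h : s(pt x' j, pt x' j') ∉ ω) :
    s(pt x j, pt x' j) ∈ dualConfig ω := by
  subst hx hj
  have hadj : (zdGraph 2).Adj (pt x j) (pt (x + 1) j) := by
    rw [pt_succ_eq]; exact (zdGraph_adj_iff _ _).2 ⟨0, Or.inl rfl⟩
  refine dks_mem_dualConfig hω hadj ?_
  rwa [pt_succ_eq, sepEdge_right, ← pt_succ_eq, ← pt_succ_eq']

/-- A vertical dual step `(x, j) → (x, j+1)` of faces is dual-open if the horizontal primal edge
`{(x, j+1), (x+1, j+1)}` it crosses is closed. [folklore] -/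
theorem cod_dual_vstep {ω : BondConfig (Site 2)} (hω : ω ⊆ (zdGraph 2).edgeSet) {x x' j j' : ℤ}
    (hx : x' = x + 1) (hj : j' = j + 1) (h : s(pt x j', pt x' j') ∉ ω) :
    s(pt x j, pt x j') ∈ dualConfig ω := by
  subst hx hj
  have hadj : (zdGraph 2).Adj (pt x j) (pt x (j + 1)) := by
    rw [pt_succ_eq']; exact (zdGraph_adj_iff _ _).2 ⟨1, Or.inl rfl⟩
  refine dks_mem_dualConfig hω hadj ?_
  rwa [pt_succ_eq', sepEdge_up, ← pt_succ_eq', ← pt_succ_eq]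

/-- From an open path of the translated box `v + [0, m] × [0, n]` joining (translates of) its bottom
and top sides to the translated top-bottom crossing event (`relabel_mem_openConnIn`). [folklore] -/
theorem cod_mem_preimage_relabel_tbCrossing {v x y : Site 2} {ω : BondConfig (Site 2)} {m n : ℕ}
    (h : ω ∈ openConnIn ((· + v) '' (rectangle m n : Set (Site 2))) x y)
    (hx : x - v ∈ bottomSide m n) (hy : y - v ∈ topSide m n) :
    ω ∈ (BondConfig.relabel (sym2Equiv (Site.shift (-v)))) ⁻¹' tbCrossing m n := by
  have h' := relabel_mem_openConnIn (Site.shift (-v)) h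
  have hS : (Site.shift (-v)) '' ((· + v) '' (rectangle m n : Set (Site 2))) =
      (rectangle m n : Set (Site 2)) := by
    ext z; simp [Set.image_image]
  rw [hS] at h'
  refine ⟨x - v, Finset.mem_coe.2 hx, y - v, Finset.mem_coe.2 hy, ?_⟩
  simpa [sub_eq_add_neg] using h'

/-! ## The five pieces of the end-confined event -/

/-- The left bottom fence: column `0` open from row `0` to row `b`. [folklore] -/
theorem cod_fenceBottom {b : ℕ} {ω : BondConfig (Site 2)}
    (hcol : ∀ j : ℤ, 0 ≤ j → j < b → s(pt 0 j, pt 0 (j + 1)) ∈ ω) : ω ∈ tbCrossing b b := by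
  refine ⟨pt 0 0, ?_, pt 0 b, ?_, cod_vrun (by omega) (fun j h0 h1 => ?_) hcol⟩
  · simp [bottomSide, mem_rectangle_iff, pt]
  · simp [topSide, mem_rectangle_iff, pt]
  · simp only [Finset.mem_coe, mem_rectangle_iff, pt, Matrix.cons_val_zero, Matrix.cons_val_one,
      Matrix.cons_val_fin_one]
    omega

/-- The left top fence: column `0` open from row `2b+2` to row `3b+2`, as the translated crossing
event. [folklore] -/
theorem cod_fenceTop {b : ℕ} {ω : BondConfig (Site 2)}
    (hcol : ∀ j : ℤ, 2 * (b : ℤ) + 2 ≤ j → j < 3 * (b : ℤ) + 2 → s(pt 0 j, pt 0 (j + 1)) ∈ ω) :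
    ω ∈ (BondConfig.relabel (sym2Equiv (Site.shift (-pt 0 (2 * (b : ℤ) + 2))))) ⁻¹' tbCrossing b b := by
  refine cod_mem_preimage_relabel_tbCrossing (x := pt 0 (2 * (b : ℤ) + 2)) (y := pt 0 (3 * (b : ℤ) + 2))
    (cod_vrun (by omega) (fun j h0 h1 => ?_) hcol) ?_ ?_
  · rw [mem_image_rectangle_iff]
    simp only [pt, Matrix.cons_val_zero, Matrix.cons_val_one, Matrix.cons_val_fin_one]
    omega
  · simp [bottomSide, mem_rectangle_iff, pt]
  · simp only [topSide, Finset.mem_filter, mem_rectangle_iff, pt, Pi.sub_apply, Matrix.cons_val_zero,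
      Matrix.cons_val_one, Matrix.cons_val_fin_one]
    omega

/-- **The confined bottom crossing** of the long block: row `0` to `(b+2, 0)`, up the column `b+2`,
the bridge into the block, the docked LOW path, the bridge out, down the column `M+b+4`, row `0`;
all edges outside the block are open by the end patterns. [folklore] -/
theorem cod_confinedBottom : ∀ (b M : ℕ) (ω : BondConfig (Site 2)) (r r' y₀ y₀' : ℕ),
    r + 1 ≤ 3 * b + 2 → r' + 1 ≤ 3 * b + 2 → y₀ ≤ r → y₀' ≤ r' →
    ω ∈ openConnIn {z : Site 2 | (b : ℤ) + 3 ≤ z 0 ∧ z 0 ≤ (b : ℤ) + 3 + M ∧ 0 ≤ z 1 ∧ z 1 ≤ 3 * (b : ℤ) + 2} (pt ((b : ℤ) + 3) y₀) (pt ((b : ℤ) + 3 + M) y₀') →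
    (∀ x x' j : ℤ, x' = x + 1 → 0 ≤ x → x ≤ (b : ℤ) + 2 → 0 ≤ j → j ≤ 3 * (b : ℤ) + 2 →
      ¬ (x = (b : ℤ) + 1 ∧ min (r : ℤ) ((b : ℤ) + 1) < j ∧ j ≤ max (r : ℤ) ((b : ℤ) + 1)) →
      s(pt x j, pt x' j) ∈ ω) →
    (∀ x j j' : ℤ, j' = j + 1 → 0 ≤ x → x ≤ (b : ℤ) + 2 → 0 ≤ j → j' ≤ 3 * (b : ℤ) + 2 →
      ¬ ((x ≤ (b : ℤ) + 1 ∧ j = (b : ℤ) + 1) ∨ (x = (b : ℤ) + 2 ∧ j = (r : ℤ))) → s(pt x j, pt x j') ∈ ω) →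
    (∀ x x' j : ℤ, x' = x + 1 → (M : ℤ) + b + 3 ≤ x → x' ≤ (M : ℤ) + 2 * b + 6 → 0 ≤ j →
      j ≤ 3 * (b : ℤ) + 2 →
      ¬ (x = (M : ℤ) + b + 4 ∧ min (r' : ℤ) ((b : ℤ) + 1) < j ∧ j ≤ max (r' : ℤ) ((b : ℤ) + 1)) →
      s(pt x j, pt x' j) ∈ ω) →
    (∀ x j j' : ℤ, j' = j + 1 → (M : ℤ) + b + 4 ≤ x → x ≤ (M : ℤ) + 2 * b + 6 → 0 ≤ j →
      j' ≤ 3 * (b : ℤ) + 2 →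
      ¬ (((M : ℤ) + b + 5 ≤ x ∧ j = (b : ℤ) + 1) ∨ (x = (M : ℤ) + b + 4 ∧ j = (r' : ℤ))) →
      s(pt x j, pt x j') ∈ ω) →
    ω ∈ openCrossing {z ∈ (rectangle (M + 2 * (b + 3)) (3 * b + 2) : Set (Site 2)) | (z 0 ≤ (b : ℤ) ∨ ((M + 2 * (b + 3) : ℕ) : ℤ) ≤ z 0 + b) → z 1 ≤ (b : ℤ)} (leftSide (M + 2 * (b + 3)) (3 * b + 2) : Set (Site 2)) (rightSide (M + 2 * (b + 3)) (3 * b + 2) : Set (Site 2)) := by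
  intro b M ω r r' y₀ y₀' hr hr' hy₀ hy₀' hLow hLh hLv hRh hRv
  set S : Set (Site 2) := {z ∈ (rectangle (M + 2 * (b + 3)) (3 * b + 2) : Set (Site 2)) |
    (z 0 ≤ (b : ℤ) ∨ ((M + 2 * (b + 3) : ℕ) : ℤ) ≤ z 0 + b) → z 1 ≤ (b : ℤ)} with hS
  have hmem : ∀ x j : ℤ, 0 ≤ x → x ≤ (M : ℤ) + 2 * b + 6 → 0 ≤ j → j ≤ 3 * (b : ℤ) + 2 →
      ((x ≤ b ∨ (M : ℤ) + 2 * b + 6 ≤ x + b) → j ≤ b) → pt x j ∈ S := by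
    intro x j h0 h1 h2 h3 h4
    simp only [hS, Set.mem_setOf_eq, Finset.mem_coe, mem_rectangle_iff, pt, Matrix.cons_val_zero,
      Matrix.cons_val_one, Matrix.cons_val_fin_one]
    omega
  -- row `0` to `(b+2, 0)`, up the column `b+2` to `(b+2, y₀)`, the bridge into the block
  have s₁ : ω ∈ openConnIn S (pt 0 0) (pt ((b : ℤ) + 2) 0) :=
    cod_hrun (by omega) (fun x h0 h1 => hmem x 0 h0 (by omega) le_rfl (by omega) (fun _ => by omega))
      (fun x h0 h1 => hLh x (x + 1) 0 rfl h0 (by omega) le_rfl (by omega) (by omega))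
  have s₂ : ω ∈ openConnIn S (pt ((b : ℤ) + 2) 0) (pt ((b : ℤ) + 2) y₀) :=
    cod_vrun (by omega) (fun j h0 h1 => hmem _ j (by omega) (by omega) h0 (by omega) (fun _ => by omega))
      (fun j h0 h1 => hLv _ j (j + 1) rfl (by omega) le_rfl h0 (by omega) (by omega))
  have s₃ : ω ∈ openConnIn S (pt ((b : ℤ) + 2) y₀) (pt ((b : ℤ) + 3) y₀) :=
    cod_adj_h (by ring) (hmem _ _ (by omega) (by omega) (by omega) (by omega) (fun _ => by omega))
      (hmem _ _ (by omega) (by omega) (by omega) (by omega) (fun _ => by omega))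
      (hLh _ _ _ (by ring) (by omega) le_rfl (by omega) (by omega) (by omega))
  -- the docked LOW path of the block
  have s₄ : ω ∈ openConnIn S (pt ((b : ℤ) + 3) y₀) (pt ((b : ℤ) + 3 + M) y₀') := by
    refine openConnIn_mono (fun z hz => ?_) _ _ hLow
    simp only [Set.mem_setOf_eq] at hz
    simp only [hS, Set.mem_setOf_eq, Finset.mem_coe, mem_rectangle_iff]
    omega
  -- the bridge out of the block, down the column `M+b+4`, row `0` to the right side
  have s₅ : ω ∈ openConnIn S (pt ((b : ℤ) + 3 + M) y₀') (pt ((M : ℤ) + b + 4) y₀') :=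
    cod_adj_h (by ring) (hmem _ _ (by omega) (by omega) (by omega) (by omega) (fun _ => by omega))
      (hmem _ _ (by omega) (by omega) (by omega) (by omega) (fun _ => by omega))
      (hRh _ _ _ (by ring) (by omega) (by omega) (by omega) (by omega) (by omega))
  have s₆ : ω ∈ openConnIn S (pt ((M : ℤ) + b + 4) y₀') (pt ((M : ℤ) + b + 4) 0) := by
    rw [openConnIn_comm]
    exact cod_vrun (by omega) (fun j h0 h1 => hmem _ j (by omega) (by omega) h0 (by omega) (fun _ => by omega))
      (fun j h0 h1 => hRv _ j (j + 1) rfl le_rfl (by omega) h0 (by omega) (by omega))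
  have s₇ : ω ∈ openConnIn S (pt ((M : ℤ) + b + 4) 0) (pt ((M : ℤ) + 2 * b + 6) 0) :=
    cod_hrun (by omega) (fun x h0 h1 => hmem x 0 (by omega) h1 le_rfl (by omega) (fun _ => by omega))
      (fun x h0 h1 => hRh x (x + 1) 0 rfl (by omega) (by omega) le_rfl (by omega) (by omega))
  exact ⟨pt 0 0, cod_mem_leftSide (by omega), pt ((M : ℤ) + 2 * b + 6) 0, cod_mem_rightSide (by omega),
    PlanarDuality.openConnIn_trans (PlanarDuality.openConnIn_trans (PlanarDuality.openConnIn_trans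
      (PlanarDuality.openConnIn_trans (PlanarDuality.openConnIn_trans (PlanarDuality.openConnIn_trans s₁ s₂)
      s₃) s₄) s₅) s₆) s₇⟩

/-- **The confined top crossing** of the long block: row `3b+2` to `(b+2, 3b+2)`, down the column
`b+2` to `(b+2, y₁)`, the bridge into the block, the docked HIGH path, the bridge out, up the column
`M+b+4`, row `3b+2`. [folklore] -/
theorem cod_confinedTop : ∀ (b M : ℕ) (ω : BondConfig (Site 2)) (r r' y₁ y₁' : ℕ),
    r + 1 ≤ y₁ → y₁ ≤ 3 * b + 2 → r' + 1 ≤ y₁' → y₁' ≤ 3 * b + 2 →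
    ω ∈ openConnIn {z : Site 2 | (b : ℤ) + 3 ≤ z 0 ∧ z 0 ≤ (b : ℤ) + 3 + M ∧ 0 ≤ z 1 ∧ z 1 ≤ 3 * (b : ℤ) + 2} (pt ((b : ℤ) + 3) y₁) (pt ((b : ℤ) + 3 + M) y₁') →
    (∀ x x' j : ℤ, x' = x + 1 → 0 ≤ x → x ≤ (b : ℤ) + 2 → 0 ≤ j → j ≤ 3 * (b : ℤ) + 2 →
      ¬ (x = (b : ℤ) + 1 ∧ min (r : ℤ) ((b : ℤ) + 1) < j ∧ j ≤ max (r : ℤ) ((b : ℤ) + 1)) →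
      s(pt x j, pt x' j) ∈ ω) →
    (∀ x j j' : ℤ, j' = j + 1 → 0 ≤ x → x ≤ (b : ℤ) + 2 → 0 ≤ j → j' ≤ 3 * (b : ℤ) + 2 →
      ¬ ((x ≤ (b : ℤ) + 1 ∧ j = (b : ℤ) + 1) ∨ (x = (b : ℤ) + 2 ∧ j = (r : ℤ))) → s(pt x j, pt x j') ∈ ω) →
    (∀ x x' j : ℤ, x' = x + 1 → (M : ℤ) + b + 3 ≤ x → x' ≤ (M : ℤ) + 2 * b + 6 → 0 ≤ j →
      j ≤ 3 * (b : ℤ) + 2 →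
      ¬ (x = (M : ℤ) + b + 4 ∧ min (r' : ℤ) ((b : ℤ) + 1) < j ∧ j ≤ max (r' : ℤ) ((b : ℤ) + 1)) →
      s(pt x j, pt x' j) ∈ ω) →
    (∀ x j j' : ℤ, j' = j + 1 → (M : ℤ) + b + 4 ≤ x → x ≤ (M : ℤ) + 2 * b + 6 → 0 ≤ j →
      j' ≤ 3 * (b : ℤ) + 2 →
      ¬ (((M : ℤ) + b + 5 ≤ x ∧ j = (b : ℤ) + 1) ∨ (x = (M : ℤ) + b + 4 ∧ j = (r' : ℤ))) →
      s(pt x j, pt x j') ∈ ω) →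
    ω ∈ openCrossing {z ∈ (rectangle (M + 2 * (b + 3)) (3 * b + 2) : Set (Site 2)) | (z 0 ≤ (b : ℤ) ∨ ((M + 2 * (b + 3) : ℕ) : ℤ) ≤ z 0 + b) → 2 * (b : ℤ) + 2 ≤ z 1} (leftSide (M + 2 * (b + 3)) (3 * b + 2) : Set (Site 2)) (rightSide (M + 2 * (b + 3)) (3 * b + 2) : Set (Site 2)) := by
  intro b M ω r r' y₁ y₁' hy₁ hy₁n hy₁' hy₁'n hHigh hLh hLv hRh hRv
  set S : Set (Site 2) := {z ∈ (rectangle (M + 2 * (b + 3)) (3 * b + 2) : Set (Site 2)) |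
    (z 0 ≤ (b : ℤ) ∨ ((M + 2 * (b + 3) : ℕ) : ℤ) ≤ z 0 + b) → 2 * (b : ℤ) + 2 ≤ z 1} with hS
  have hmem : ∀ x j : ℤ, 0 ≤ x → x ≤ (M : ℤ) + 2 * b + 6 → 0 ≤ j → j ≤ 3 * (b : ℤ) + 2 →
      ((x ≤ b ∨ (M : ℤ) + 2 * b + 6 ≤ x + b) → 2 * (b : ℤ) + 2 ≤ j) → pt x j ∈ S := by
    intro x j h0 h1 h2 h3 h4
    simp only [hS, Set.mem_setOf_eq, Finset.mem_coe, mem_rectangle_iff, pt, Matrix.cons_val_zero,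
      Matrix.cons_val_one, Matrix.cons_val_fin_one]
    omega
  -- row `3b+2` to `(b+2, 3b+2)`, down the column `b+2` to `(b+2, y₁)`, the bridge into the block
  have t₁ : ω ∈ openConnIn S (pt 0 (3 * (b : ℤ) + 2)) (pt ((b : ℤ) + 2) (3 * (b : ℤ) + 2)) :=
    cod_hrun (by omega) (fun x h0 h1 => hmem x _ h0 (by omega) (by omega) le_rfl (fun _ => by omega))
      (fun x h0 h1 => hLh x (x + 1) _ rfl h0 (by omega) (by omega) le_rfl (by omega))
  have t₂ : ω ∈ openConnIn S (pt ((b : ℤ) + 2) (3 * (b : ℤ) + 2)) (pt ((b : ℤ) + 2) y₁) := by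
    rw [openConnIn_comm]
    exact cod_vrun (by omega) (fun j h0 h1 => hmem _ j (by omega) (by omega) (by omega) h1 (fun _ => by omega))
      (fun j h0 h1 => hLv _ j (j + 1) rfl (by omega) le_rfl (by omega) (by omega) (by omega))
  have t₃ : ω ∈ openConnIn S (pt ((b : ℤ) + 2) y₁) (pt ((b : ℤ) + 3) y₁) :=
    cod_adj_h (by ring) (hmem _ _ (by omega) (by omega) (by omega) (by omega) (fun _ => by omega))
      (hmem _ _ (by omega) (by omega) (by omega) (by omega) (fun _ => by omega))
      (hLh _ _ _ (by ring) (by omega) le_rfl (by omega) (by omega) (by omega))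
  -- the docked HIGH path of the block
  have t₄ : ω ∈ openConnIn S (pt ((b : ℤ) + 3) y₁) (pt ((b : ℤ) + 3 + M) y₁') := by
    refine openConnIn_mono (fun z hz => ?_) _ _ hHigh
    simp only [Set.mem_setOf_eq] at hz
    simp only [hS, Set.mem_setOf_eq, Finset.mem_coe, mem_rectangle_iff]
    omega
  -- the bridge out of the block, up the column `M+b+4`, row `3b+2` to the right side
  have t₅ : ω ∈ openConnIn S (pt ((b : ℤ) + 3 + M) y₁') (pt ((M : ℤ) + b + 4) y₁') :=
    cod_adj_h (by ring) (hmem _ _ (by omega) (by omega) (by omega) (by omega) (fun _ => by omega))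
      (hmem _ _ (by omega) (by omega) (by omega) (by omega) (fun _ => by omega))
      (hRh _ _ _ (by ring) (by omega) (by omega) (by omega) (by omega) (by omega))
  have t₆ : ω ∈ openConnIn S (pt ((M : ℤ) + b + 4) y₁') (pt ((M : ℤ) + b + 4) (3 * (b : ℤ) + 2)) :=
    cod_vrun (by omega) (fun j h0 h1 => hmem _ j (by omega) (by omega) (by omega) h1 (fun _ => by omega))
      (fun j h0 h1 => hRv _ j (j + 1) rfl le_rfl (by omega) (by omega) (by omega) (by omega))
  have t₇ : ω ∈ openConnIn S (pt ((M : ℤ) + b + 4) (3 * (b : ℤ) + 2))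
      (pt ((M : ℤ) + 2 * b + 6) (3 * (b : ℤ) + 2)) :=
    cod_hrun (by omega) (fun x h0 h1 => hmem x _ (by omega) h1 (by omega) le_rfl (fun _ => by omega))
      (fun x h0 h1 => hRh x (x + 1) _ rfl (by omega) (by omega) (by omega) le_rfl (by omega))
  exact ⟨pt 0 (3 * (b : ℤ) + 2), cod_mem_leftSide (by omega), pt ((M : ℤ) + 2 * b + 6) (3 * (b : ℤ) + 2),
    cod_mem_rightSide (by omega),
    PlanarDuality.openConnIn_trans (PlanarDuality.openConnIn_trans (PlanarDuality.openConnIn_trans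
      (PlanarDuality.openConnIn_trans (PlanarDuality.openConnIn_trans (PlanarDuality.openConnIn_trans t₁ t₂)
      t₃) t₄) t₅) t₆) t₇⟩

end Summit.CriticalPhenomena.CardyFormulaZ2.Cruxes.StripClusterRates.TwoClusterRateIsStationaryGap

end
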